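import Summits.NavierStokesRegularity.NavierStokesRegularity.Theorems.ExtremiserTransienceNearExtremalTransienceExtremiserLiouvilleConstantSpeedMultiplierStrongEL
import HarnessLib

/-!
# Crux `ExtremiserTransience.NearExtremalTransience` (stmt-NavierStokesRegularity-21883), line `extremiser_liouville`,
# stub K1b — THE MULTIPLIER DENSITY IS INTEGRABLE ON THE TWIST SET: `q = ⟪G,v⟫/⟪v,curl v⟫ ∈ L¹(U)`, `∫_U q ≤ μ(ℝ³) ≤ κ⋆²ZW`

`--supports stmt-NavierStokesRegularity-21883` (helper).  Author: prover seat `ns-el-k1b` (g3).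

`…ConstantSpeedMultiplierStrongEL.multiplier_eq_density_on_twist_ne_zero` says `∫θ dμ = ∫θ·q dx` for smooth `θ` compactly
supported in the (open) twist set `U = {⟪v, curl v⟫ ≠ 0}`, `q := ⟪G,v⟫/⟪v,curl v⟫`, and the sign law makes `q ≥ 0` on `U`.
Exhausting `U` by smooth cut-offs (`IsOpen.exists_contDiff_support_eq` + `Real.smoothTransition` + the tree's radial cut-off)
and Fatou's lemma:

(`multiplierDensity_nonneg` of `…MultiplierStrongEL`: `q ≥ 0`.)
* `lintegral_density_le_measure_univ` : **`∫⁻_U q ≤ μ(ℝ³)`**;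
* `integrableOn_density_twistSet` : **`q ∈ L¹(U)`** and **`∫_U q dx ≤ μ(ℝ³)`** (so `≤ κ⋆²ZW = S²/M²` for the multiplier of
  `exists_multiplierMeasure`) — the rigorous anchor of the far-field analysis of the residue object
  (`Lines/extremiser_liouville_k1b_multiplier.md`, items 2, 5, 7): the explicit analytic function `⟪G,v⟫/⟪v,curl v⟫` of the residue
  object must be integrable at infinity on the twist set;
* `residue_density_integrable` : the package with the explicit `G` (all inputs discharged).

WHAT THIS IS NOT: a necessary condition on the HYPOTHETICAL K1b residue object; K1b is NOT proved; nothing here proves NS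
regularity. [folklore]
-/

noncomputable section

open Set Filter Topology MeasureTheory Metric Function
open scoped ENNReal NNReal Topology InnerProductSpace RealInnerProductSpace ContDiff Laplacian
open Literature.Analysis.FluidPDE Literature.Analysis

namespace Summit.NavierStokesRegularity.NavierStokesRegularity.Theorems

-- the problem directory repeats the summit name (`NavierStokesRegularity/NavierStokesRegularity`)
set_option linter.dupNamespace false

namespace ExtremiserLiouville

open DepletionLadder.KStar DepletionLadder.KStar.HalfSpace

variable {v G : E3 → E3} {M : ℝ} {μ : Measure E3}

/-- **`∫⁻_U q ≤ μ(ℝ³)`** on the twist set `U`, by exhaustion with smooth cut-offs supported in `U` and Fatou. [folklore] -/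
theorem lintegral_density_le_measure_univ (hv : ContDiff ℝ ∞ v) (hGc : Continuous G)
    (hG : ∀ η : E3 → E3, ContDiff ℝ ∞ η → HasCompactSupport η →
      Jst v * J1 v (curl η) - kStar ^ 2 * M ^ 2 * (Wpa v * A1 v (curl η) + Zen v * C1 v (curl η)) = ∫ x, ⟪G x, η x⟫_ℝ)
    [IsFiniteMeasure μ]
    (hμ : ∀ φ : E3 → E3, ContDiff ℝ ∞ φ → HasCompactSupport φ → VectorCalculus.IsDivFree φ →
      Jst v * J1 v φ - kStar ^ 2 * M ^ 2 * (Wpa v * A1 v φ + Zen v * C1 v φ) = ∫ x, ⟪v x, φ x⟫_ℝ ∂μ) :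
    ∫⁻ x in {x | ⟪v x, curl v x⟫_ℝ ≠ 0}, ENNReal.ofReal (⟪G x, v x⟫_ℝ / ⟪v x, curl v x⟫_ℝ) ≤ μ univ := by
  set U : Set E3 := {x | ⟪v x, curl v x⟫_ℝ ≠ 0} with hUdef
  set q : E3 → ℝ := fun x => ⟪G x, v x⟫_ℝ / ⟪v x, curl v x⟫_ℝ with hqdef
  have hh : ContDiff ℝ ∞ fun x => ⟪v x, curl v x⟫_ℝ := hv.inner ℝ (contDiff_curl_top hv)
  have hg : Continuous fun x => ⟪G x, v x⟫_ℝ := hGc.inner hv.continuous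
  have hUo : IsOpen U := isOpen_ne_fun hh.continuous continuous_const
  have hq0 : ∀ x, 0 ≤ q x := multiplierDensity_nonneg hv hGc hG hμ
  have hqc : ContinuousOn q U := hg.continuousOn.div hh.continuous.continuousOn fun x hx => hx
  -- a smooth function with support exactly `U`
  obtain ⟨f, hfsupp, hf, hfrange⟩ := hUo.exists_contDiff_support_eq (n := ⊤)
  have hf01 : ∀ x, 0 ≤ f x ∧ f x ≤ 1 := fun x => by
    have := hfrange (mem_range_self x)
    exact ⟨this.1, this.2⟩
  -- the cut-offs `θ_n = χ_n · smoothTransition (n f − 1)`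
  set θ : ℕ → E3 → ℝ := fun n x => cutoff ((n : ℝ) + 1) x * Real.smoothTransition ((n : ℝ) * f x - 1) with hθdef
  have hθs : ∀ n, ContDiff ℝ ∞ (θ n) := fun n =>
    (contDiff_cutoff _).mul (Real.smoothTransition.contDiff.comp ((contDiff_const.mul hf).sub contDiff_const))
  have hθc : ∀ n, HasCompactSupport (θ n) := fun n =>
    (hasCompactSupport_cutoff (by positivity : (0 : ℝ) < (n : ℝ) + 1)).mul_right
  have hθ01 : ∀ n x, 0 ≤ θ n x ∧ θ n x ≤ 1 := fun n x =>
    ⟨mul_nonneg (cutoff_nonneg _ _) (Real.smoothTransition.nonneg _),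
      mul_le_one₀ (cutoff_le_one _ _) (Real.smoothTransition.nonneg _) (Real.smoothTransition.le_one _)⟩
  have hθU : ∀ n, tsupport (θ n) ⊆ U := by
    intro n
    -- `θ n` vanishes on the open neighbourhood `{f < 1/(n+1)}`-type set of `Uᶜ`; precisely: support θ_n ⊆ {f > 1/n'}...
    have hsub : Function.support (θ n) ⊆ {x | (1 : ℝ) / ((n : ℝ) + 1) < f x} := by
      intro x hx
      rw [Function.mem_support] at hx
      rw [mem_setOf_eq]
      by_contra hle
      rw [not_lt] at hle
      have hnf : (n : ℝ) * f x - 1 ≤ 0 := by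
        have hn0 : (0 : ℝ) ≤ n := Nat.cast_nonneg n
        have : (n : ℝ) * f x ≤ (n : ℝ) * (1 / ((n : ℝ) + 1)) := mul_le_mul_of_nonneg_left hle hn0
        have h2 : (n : ℝ) * (1 / ((n : ℝ) + 1)) ≤ 1 := by
          rw [mul_one_div, div_le_one (by positivity)]; linarith
        linarith
      exact hx (by rw [hθdef]; simp only; rw [Real.smoothTransition.zero_of_nonpos hnf, mul_zero])
    have hclosed : IsClosed {x | (1 : ℝ) / ((n : ℝ) + 1) ≤ f x} := isClosed_le continuous_const hf.continuous
    have hsub' : Function.support (θ n) ⊆ {x | (1 : ℝ) / ((n : ℝ) + 1) ≤ f x} := fun x hx => by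
      have h := hsub hx
      rw [mem_setOf_eq] at h ⊢
      exact h.le
    refine (closure_minimal hsub' hclosed).trans fun x hx => ?_
    rw [mem_setOf_eq] at hx
    have hfx : f x ≠ 0 := by intro h0; rw [h0] at hx; exact absurd hx (not_le.2 (by positivity))
    have : x ∈ Function.support f := hfx
    rwa [hfsupp] at this
  -- pointwise convergence `θ n x → 1` on `U`
  have hθlim : ∀ x ∈ U, Tendsto (fun n => θ n x) atTop (𝓝 1) := by
    intro x hx
    have hfx : 0 < f x := by
      have hx' : x ∈ Function.support f := by rw [hfsupp]; exact hx
      exact lt_of_le_of_ne (hf01 x).1 (Ne.symm hx')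
    refine (tendsto_const_nhds (x := (1 : ℝ))).congr' ?_
    obtain ⟨N₁, hN₁⟩ := exists_nat_ge ‖x‖
    obtain ⟨N₂, hN₂⟩ := exists_nat_ge (2 / f x)
    filter_upwards [eventually_ge_atTop (max N₁ N₂)] with n hn
    have hn1 : (N₁ : ℝ) ≤ n := by exact_mod_cast le_trans (le_max_left _ _) hn
    have hn2 : (N₂ : ℝ) ≤ n := by exact_mod_cast le_trans (le_max_right _ _) hn
    have hcut : cutoff ((n : ℝ) + 1) x = 1 := cutoff_eq_one (by positivity) (by linarith)
    have hst : Real.smoothTransition ((n : ℝ) * f x - 1) = 1 := by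
      refine Real.smoothTransition.one_of_one_le ?_
      have h2 : 2 ≤ (n : ℝ) * f x := by
        have : 2 / f x ≤ (n : ℝ) := hN₂.trans hn2
        rw [div_le_iff₀ hfx] at this
        exact this
      linarith
    show (1 : ℝ) = θ n x
    rw [hθdef]; simp only; rw [hcut, hst, mul_one]
  -- Fatou
  have hmeas : ∀ n, Measurable fun x => ENNReal.ofReal (θ n x * q x) := by
    intro n
    refine ENNReal.measurable_ofReal.comp ?_
    have hcont : Continuous fun x => θ n x * q x :=
      continuous_of_tsupport fun x hx => by
        have hxU : x ∈ U := hθU n ((tsupport_mul_subset_left) hx)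
        exact ((hθs n).continuous.continuousAt).mul (hqc.continuousAt (hUo.mem_nhds hxU))
    exact hcont.measurable
  have hliminf : ∀ x, liminf (fun n => ENNReal.ofReal (θ n x * q x)) atTop = U.indicator (fun x => ENNReal.ofReal (q x)) x := by
    intro x
    by_cases hx : x ∈ U
    · rw [indicator_of_mem hx]
      have ht : Tendsto (fun n => ENNReal.ofReal (θ n x * q x)) atTop (𝓝 (ENNReal.ofReal (q x))) := by
        have := ((hθlim x hx).mul_const (q x))
        rw [one_mul] at this
        exact ENNReal.tendsto_ofReal this
      exact ht.liminf_eq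
    · rw [indicator_of_notMem hx]
      have h0 : ∀ n, θ n x = 0 := fun n => by
        by_contra hne
        exact hx (hθU n (subset_tsupport _ (Function.mem_support.2 hne)))
      simp [h0]
  have hfatou := lintegral_liminf_le (μ := (volume : Measure E3)) (u := (atTop : Filter ℕ)) hmeas
  simp_rw [hliminf] at hfatou
  rw [lintegral_indicator hUo.measurableSet] at hfatou
  refine hfatou.trans ?_
  -- each term is `≤ μ univ`
  refine liminf_le_of_frequently_le' (Frequently.of_forall fun n => ?_)
  have hint : Integrable (fun x => θ n x * q x) := by
    refine Continuous.integrable_of_hasCompactSupport ?_ ((hθc n).mul_right)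
    exact continuous_of_tsupport fun x hx => by
      have hxU : x ∈ U := hθU n ((tsupport_mul_subset_left) hx)
      exact ((hθs n).continuous.continuousAt).mul (hqc.continuousAt (hUo.mem_nhds hxU))
  have hnn : 0 ≤ᵐ[volume] fun x => θ n x * q x := Eventually.of_forall fun x => mul_nonneg (hθ01 n x).1 (hq0 x)
  have hid' : ∫ x, θ n x * q x = ∫ x, θ n x ∂μ :=
    (multiplier_eq_density_on_twist_ne_zero hv hG hμ (hθs n) (hθc n) (hθU n)).symm
  rw [← ofReal_integral_eq_lintegral_ofReal hint hnn, hid']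
  -- `∫ θ_n dμ ≤ μ univ`
  have hle : ∫ x, θ n x ∂μ ≤ μ.real univ := by
    calc ∫ x, θ n x ∂μ ≤ ∫ x, (1 : ℝ) ∂μ :=
          integral_mono_of_nonneg (Eventually.of_forall fun x => (hθ01 n x).1) (integrable_const _)
            (Eventually.of_forall fun x => (hθ01 n x).2)
      _ = μ.real univ := by rw [integral_const, smul_eq_mul, mul_one]
  calc ENNReal.ofReal (∫ x, θ n x ∂μ) ≤ ENNReal.ofReal (μ.real univ) := ENNReal.ofReal_le_ofReal hle
    _ = μ univ := by rw [measureReal_def, ENNReal.ofReal_toReal (measure_ne_top μ _)]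

/-- **`q = ⟪G,v⟫/⟪v,curl v⟫ ∈ L¹(U)` and `∫_U q ≤ μ(ℝ³)`** on the twist set `U = {⟪v,curl v⟫ ≠ 0}`. [folklore] -/
theorem integrableOn_density_twistSet (hv : ContDiff ℝ ∞ v) (hGc : Continuous G)
    (hG : ∀ η : E3 → E3, ContDiff ℝ ∞ η → HasCompactSupport η →
      Jst v * J1 v (curl η) - kStar ^ 2 * M ^ 2 * (Wpa v * A1 v (curl η) + Zen v * C1 v (curl η)) = ∫ x, ⟪G x, η x⟫_ℝ)
    [IsFiniteMeasure μ]
    (hμ : ∀ φ : E3 → E3, ContDiff ℝ ∞ φ → HasCompactSupport φ → VectorCalculus.IsDivFree φ →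
      Jst v * J1 v φ - kStar ^ 2 * M ^ 2 * (Wpa v * A1 v φ + Zen v * C1 v φ) = ∫ x, ⟪v x, φ x⟫_ℝ ∂μ) :
    IntegrableOn (fun x => ⟪G x, v x⟫_ℝ / ⟪v x, curl v x⟫_ℝ) {x | ⟪v x, curl v x⟫_ℝ ≠ 0} ∧
      ∫ x in {x | ⟪v x, curl v x⟫_ℝ ≠ 0}, ⟪G x, v x⟫_ℝ / ⟪v x, curl v x⟫_ℝ ≤ μ.real univ := by
  set U : Set E3 := {x | ⟪v x, curl v x⟫_ℝ ≠ 0} with hUdef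
  have hh : ContDiff ℝ ∞ fun x => ⟪v x, curl v x⟫_ℝ := hv.inner ℝ (contDiff_curl_top hv)
  have hg : Continuous fun x => ⟪G x, v x⟫_ℝ := hGc.inner hv.continuous
  have hUo : IsOpen U := isOpen_ne_fun hh.continuous continuous_const
  have hq0 : ∀ x, 0 ≤ ⟪G x, v x⟫_ℝ / ⟪v x, curl v x⟫_ℝ := multiplierDensity_nonneg hv hGc hG hμ
  have hqc : ContinuousOn (fun x => ⟪G x, v x⟫_ℝ / ⟪v x, curl v x⟫_ℝ) U :=
    hg.continuousOn.div hh.continuous.continuousOn fun x hx => hx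
  have hlin := lintegral_density_le_measure_univ hv hGc hG hμ
  have hmeas : AEStronglyMeasurable (fun x => ⟪G x, v x⟫_ℝ / ⟪v x, curl v x⟫_ℝ) (volume.restrict U) :=
    hqc.aestronglyMeasurable hUo.measurableSet
  have hnn : 0 ≤ᵐ[volume.restrict U] fun x => ⟪G x, v x⟫_ℝ / ⟪v x, curl v x⟫_ℝ := Eventually.of_forall hq0
  have hint : IntegrableOn (fun x => ⟪G x, v x⟫_ℝ / ⟪v x, curl v x⟫_ℝ) U := by
    refine ⟨hmeas, (hasFiniteIntegral_iff_ofReal hnn).2 (lt_of_le_of_lt hlin (measure_lt_top μ _))⟩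
  refine ⟨hint, ?_⟩
  have h := integral_eq_lintegral_of_nonneg_ae hnn hmeas
  rw [h, measureReal_def]
  exact ENNReal.toReal_mono (measure_ne_top μ _) hlin

/-- **DENSITY-INTEGRABILITY PACKAGE of the K1b residue object**: with `G` the explicit Euler–Lagrange density there is a
multiplier `μ` (`μ(ℝ³) ≤ κ⋆²ZW`) such that `⟪G,v⟫/⟪v,curl v⟫ ≥ 0` everywhere, is integrable on the twist set and
`∫_{⟪v,curl v⟫≠0} ⟪G,v⟫/⟪v,curl v⟫ dx ≤ κ⋆² Z W` ( `= S²/M²`). [folklore] -/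
theorem residue_density_integrable (hv : ContDiff ℝ ∞ v) (hdiv : VectorCalculus.IsDivFree v) {M B : ℝ}
    (hMpos : 0 < M) (hM : ∀ x, ‖v x‖ = M) (hB : ∀ x, ‖fderiv ℝ v x‖ ≤ B)
    (h1 : ∫⁻ x, ‖iteratedFDeriv ℝ 1 v x‖ₑ ^ 2 < ⊤) (h2 : ∫⁻ x, ‖iteratedFDeriv ℝ 2 v x‖ₑ ^ 2 < ⊤)
    (hatt : |Jst v| = kStar * M * Real.sqrt (Zen v) * Real.sqrt (Wpa v)) :
    let G : E3 → E3 := fun x => (Jst v • (curl (curl (fun y => fderiv ℝ v y (curl v y))) x -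
          curl (fun y => fderiv ℝ (curl v) y (curl v y)) x +
          curl (curl (fun y => ∑ j, ⟪curl v y, fderiv ℝ v y (EuclideanSpace.basisFun (Fin 3) ℝ j)⟫_ℝ •
          EuclideanSpace.basisFun (Fin 3) ℝ j)) x) +
        (-(kStar ^ 2 * M ^ 2 * Wpa v)) • curl (curl (curl v)) x -
        (-(kStar ^ 2 * M ^ 2 * Zen v)) • curl (curl (Δ (curl v))) x)
    (∀ x, 0 ≤ ⟪G x, v x⟫_ℝ / ⟪v x, curl v x⟫_ℝ) ∧
      IntegrableOn (fun x => ⟪G x, v x⟫_ℝ / ⟪v x, curl v x⟫_ℝ) {x | ⟪v x, curl v x⟫_ℝ ≠ 0} ∧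
      ∫ x in {x | ⟪v x, curl v x⟫_ℝ ≠ 0}, ⟪G x, v x⟫_ℝ / ⟪v x, curl v x⟫_ℝ ≤ kStar ^ 2 * Zen v * Wpa v := by
  intro G
  have hZ0 : 0 ≤ Zen v := integral_nonneg fun x => sq_nonneg _
  have hW0 : 0 ≤ Wpa v := integral_nonneg fun x => frobeniusNormSq_nonneg _
  obtain ⟨μ, hfin, hmass, hμ⟩ := exists_multiplierMeasure hv hdiv hMpos hM hB h1 h2 hatt
  have hGs : ContDiff ℝ ∞ G := contDiff_density hv _ _ _
  have hG : ∀ η : E3 → E3, ContDiff ℝ ∞ η → HasCompactSupport η →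
      Jst v * J1 v (curl η) - kStar ^ 2 * M ^ 2 * (Wpa v * A1 v (curl η) + Zen v * C1 v (curl η)) =
        ∫ x, ⟪G x, η x⟫_ℝ := by
    intro η hη hηc
    show _ = ∫ x, ⟪(Jst v • (curl (curl (fun y => fderiv ℝ v y (curl v y))) x -
          curl (fun y => fderiv ℝ (curl v) y (curl v y)) x +
          curl (curl (fun y => ∑ j, ⟪curl v y, fderiv ℝ v y (EuclideanSpace.basisFun (Fin 3) ℝ j)⟫_ℝ •
          EuclideanSpace.basisFun (Fin 3) ℝ j)) x) +
        (-(kStar ^ 2 * M ^ 2 * Wpa v)) • curl (curl (curl v)) x -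
        (-(kStar ^ 2 * M ^ 2 * Zen v)) • curl (curl (Δ (curl v))) x), η x⟫_ℝ
    rw [← density_formula hv (Jst v) (-(kStar ^ 2 * M ^ 2 * Wpa v)) (-(kStar ^ 2 * M ^ 2 * Zen v)) hη hηc]
    show Jst v * J1 v (curl η) - kStar ^ 2 * M ^ 2 * (Wpa v * A1 v (curl η) + Zen v * C1 v (curl η)) =
      Jst v * J1 v (curl η) + -(kStar ^ 2 * M ^ 2 * Wpa v) * A1 v (curl η) + -(kStar ^ 2 * M ^ 2 * Zen v) * C1 v (curl η)
    ring
  obtain ⟨hint, hle⟩ := integrableOn_density_twistSet hv hGs.continuous hG hμ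
  refine ⟨multiplierDensity_nonneg hv hGs.continuous hG hμ, hint, hle.trans ?_⟩
  rw [measureReal_def]
  exact ENNReal.toReal_le_of_le_ofReal (by positivity) hmass

end ExtremiserLiouville

end Summit.NavierStokesRegularity.NavierStokesRegularity.Theorems

end
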